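import Summits.AnomalousDissipation.AnomalousDissipation.Theses.TwoAndHalfD
import Summits.AnomalousDissipation.AnomalousDissipation.Theorems.TwoAndHalfDTwohalfdThesisClassicalTransfer
import Summits.AnomalousDissipation.AnomalousDissipation.Theorems.ScalarAnomalySteadySourceFormal.Negative.KillShape
import Literature.Analysis.FluidPDE.TwoHalfNavierStokes
import Literature.Analysis.FluidPDE.PassiveScalar

/-!
# Strategist census — crux `TwoAndHalfD.TwohalfdThesis` (stmt-AnomalousDissipation-0206)

Typed companions of `STRATEGY-CENSUS.md` (crux-strategist seat `cstrat-stmt-AnomalousDissipation-0206-s1`,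
2026-08-17).  Nothing here is a line or a stub; these are the SIGNATURES the census refers to, checked to
elaborate against the current tree, plus one kernel-checked implication (`S⁺_steady → X`).

* `SteadyTwohalfdWitness`      — the STRENGTHEN candidate `S⁺_steady` (steady classical 2½-D states).
* `steadyTwohalfdWitness_imp`  — `S⁺_steady → TwohalfdThesis` (via the landed classical junction
                                  `Theorems.TwohalfdThesis.twohalfdThesis_of_classicalScalarAnomaly`).
* `UniformInviscidMixer`, `MixingGivesEnvelope` — the two pieces of the best typed DECOMPOSITION attempt
  (`∃` planar family mixing at a `j`-uniform inviscid rate) ∧ (`∀` such families, diffusive releases of every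
  smooth datum obey a `j`-uniform integrable `L²` envelope), whose composition lands in the live line's kernel
  `W = stub_releasedMixingWitness` minus its Green–Kubo clause.  The census explains why the `∀` piece is refuted
  in spirit by the landed log gate (`releaseEnvelope_false_of_gradient_bound`, p91755) and why repairing it
  collapses the split back onto `W`.
-/

noncomputable section

set_option linter.dupNamespace false

namespace Summit.AnomalousDissipation.AnomalousDissipation.Cruxes.TwohalfdThesis.StrategistCensus

open MeasureTheory Set Filter Topology
open scoped ENNReal NNReal InnerProductSpace
open Literature.Analysis.FunctionSpaces Literature.Analysis.FluidPDE
open Summit.AnomalousDissipation.AnomalousDissipation.Theses.TwoAndHalfD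

/-- Local notation: the flat unit two-torus. -/
local notation "𝕋²" => UnitAddTorus (Fin 2)
/-- Local notation: planar velocity values. -/
local notation "E²" => EuclideanSpace ℝ (Fin 2)

/-! ## Strengthen: `S⁺_steady` -/

/-- **`S⁺_steady` (STRENGTHEN candidate).**  One smooth solenoidal mean-zero steady planar force `g`, one smooth
mean-zero steady source `h`, viscosities `ν_j → 0`, and for every `j` a STEADY classical planar Navier–Stokes state
`V_j` (pressure `P_j`) forced by `g` together with a STEADY classical sourced scalar `W_j`
(`V_j·∇W_j = ν_jΔW_j + h`, Prandtl number one), with `∫‖V_j‖² ≤ E`, `‖W_j‖²_{L²} ≤ B` and scalar dissipation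
`ν_j‖∇W_j‖² ≥ ε > 0` (spectral, `toReal`).  Steadiness is encoded by feeding time-constant fields to the tree's
classical notions on `[0, ∞)`.  More rigid than `X` (elliptic problems, no time averages, per-level compactness),
and `S⁺_steady → X` is kernel-checked below; the census records why the added rigidity is exactly what kills the
mechanism (autonomous planar fields: streamline solvability / `κ^{1/3}` relaxation / Prandtl–Batchelor selection /
critical-layer variance `≳ ν^{-1/6}` under the palinstrophy cap). -/
def SteadyTwohalfdWitness : Prop :=
  ∃ (g : 𝕋² → E²) (h : 𝕋² → ℝ),
    Torus.IsSmooth g ∧ Torus.IsDivFree g ∧ Torus.HasZeroMean g ∧ Torus.IsSmooth h ∧ Torus.HasZeroMean h ∧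
    ∃ (ν : ℕ → ℝ) (V : ℕ → 𝕋² → E²) (P : ℕ → 𝕋² → ℝ) (W : ℕ → 𝕋² → ℝ) (E B ε : ℝ),
      (∀ j, 0 < ν j) ∧ Tendsto ν atTop (𝓝 0) ∧
      (∀ j, Torus.IsClassicalNSSolutionOn (Ici 0) (ν j) (fun _ => g) (fun _ => V j) (fun _ => P j)) ∧
      (∀ j, Torus.IsClassicalScalarTransportForcedOn (Ici 0) (ν j) (fun _ => V j) (fun _ => h) (fun _ => W j)) ∧
      (∀ j, ∫ x, ‖V j x‖ ^ 2 ≤ E) ∧ (∀ j, Torus.scalarL2Sq (W j) ≤ B) ∧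
      0 < ε ∧ ∀ j, ε ≤ ν j * (Torus.eScalarGradNormSq (W j)).toReal

/-- **`S⁺_steady → X`** (bookkeeping over the landed classical junction p90898): a steady classical pair is a
classical pair on `[0, ∞)` with pointwise budgets, and the `limsup` long-time mean of a constant is the constant
(`ScalarAnomalySteadySourceFormal.Negative.longTimeAvgSup_const`). [folklore] -/
theorem steadyTwohalfdWitness_imp : SteadyTwohalfdWitness → TwohalfdThesis := by
  rintro ⟨g, h, hgs, hgd, hgm, hhs, hhm, ν, V, P, W, E, B, ε, hν, hν0, hNS, hSc, hE, hB, hε, hfl⟩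
  refine Summit.AnomalousDissipation.AnomalousDissipation.Theorems.TwohalfdThesis.twohalfdThesis_of_classicalScalarAnomaly
    ⟨g, h, hgs, hgd, hgm, hhs, hhm, ν, fun j _ => V j, fun j _ => P j, fun j _ => W j, E, B, ε, hν, hν0,
      hNS, hSc, ?_, ?_, hε, ?_⟩
  · intro j t _; exact hE j
  · intro j t _; exact hB j
  · intro j
    have hc :
        longTimeAvgSup (fun _ : ℝ => ν j * (Torus.eScalarGradNormSq (W j)).toReal) =
          ν j * (Torus.eScalarGradNormSq (W j)).toReal :=
      Summit.AnomalousDissipation.AnomalousDissipation.Theorems.ScalarAnomalySteadySourceFormal.Negative.longTimeAvgSup_const _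
    simpa [hc] using hfl j

/-! ## Decomposition: the best typed split `X ⇐ Sub₁ ∧ Sub₂` (and why it collapses onto `W`) -/

/-- Shared body of the `∃`-piece: a steadily forced, pointwise-bounded-energy classical planar Navier–Stokes family
`(v_j, p_j)` that MIXES at ONE rate `r` — `r ≥ 0`, `r → 0`, integrable on `[0, ∞)` — uniformly in `j` and in the
release time `s ≥ s₀`, in the INVISCID-transport sense: every classical solution `ρ` of `∂ₜρ + v_j·∇ρ = 0` on
`[s, ∞)` released from a smooth mean-zero datum `ρ₀` satisfies the `Ḣ¹ → Ḣ⁻¹` decay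
`|∫ ρ(t) χ| ≤ r(t − s)‖∇ρ₀‖‖∇χ‖` against every smooth observable `χ` (duality form; no `H⁻¹` norm needed). -/
def IsUniformInviscidMixer (g : 𝕋² → E²) (ν : ℕ → ℝ) (v : ℕ → ℝ → 𝕋² → E²) (p : ℕ → ℝ → 𝕋² → ℝ)
    (r : ℝ → ℝ) (E s₀ : ℝ) : Prop :=
  Torus.IsSmooth g ∧ Torus.IsDivFree g ∧ Torus.HasZeroMean g ∧
  (∀ j, 0 < ν j) ∧ Tendsto ν atTop (𝓝 0) ∧
  (∀ j, Torus.IsClassicalNSSolutionOn (Ici 0) (ν j) (fun _ => g) (v j) (p j)) ∧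
  (∀ j t, 0 ≤ t → ∫ x, ‖v j t x‖ ^ 2 ≤ E) ∧ 0 ≤ s₀ ∧
  (∀ τ, 0 ≤ r τ) ∧ Tendsto r atTop (𝓝 0) ∧ IntegrableOn r (Ici 0) ∧
  ∀ (j : ℕ) (s : ℝ) (ρ₀ : 𝕋² → ℝ) (ρ : ℝ → 𝕋² → ℝ), s₀ ≤ s → Torus.IsSmooth ρ₀ → Torus.HasZeroMean ρ₀ →
    Torus.IsClassicalScalarTransportOn (Ici s) 0 (v j) ρ → ρ s = ρ₀ →
    ∀ (χ : 𝕋² → ℝ) (t : ℝ), Torus.IsSmooth χ → s ≤ t →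
      |∫ x, ρ t x * χ x| ≤
        r (t - s) * Real.sqrt (Torus.scalarGradNormSq ρ₀) * Real.sqrt (Torus.scalarGradNormSq χ)

/-- **`Sub₁` (`∃`-piece): a uniform inviscid mixer realised by steadily forced bounded-energy planar NS.** -/
def UniformInviscidMixer : Prop :=
  ∃ (g : 𝕋² → E²) (ν : ℕ → ℝ) (v : ℕ → ℝ → 𝕋² → E²) (p : ℕ → ℝ → 𝕋² → ℝ) (r : ℝ → ℝ) (E s₀ : ℝ),
    IsUniformInviscidMixer g ν v p r E s₀

/-- **`Sub₂` (`∀`-piece): uniform inviscid mixing ⇒ a `j`-uniform integrable `L²` envelope for the DIFFUSIVE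
(`κ = ν_j`) releases of every smooth mean-zero datum `h`** — the envelope clause of the live kernel `W`.  A
"mixing ⇒ dissipation enhancement" statement of Feng–Iyer / Coti Zelati–Delgadino–Elgindi type, but demanded
UNIFORMLY along `κ = ν_j → 0` at a FIXED rate `r`: refuted in spirit by the landed log gate p91755 (a `j`-uniform
loss at one lag forces unbounded drift gradients, while a fixed inviscid rate `r` is compatible with uniformly
bounded gradients), see the census. -/
def MixingGivesEnvelope : Prop :=
  ∀ (g : 𝕋² → E²) (ν : ℕ → ℝ) (v : ℕ → ℝ → 𝕋² → E²) (p : ℕ → ℝ → 𝕋² → ℝ) (r : ℝ → ℝ) (E s₀ : ℝ),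
    IsUniformInviscidMixer g ν v p r E s₀ →
    ∀ h : 𝕋² → ℝ, Torus.IsSmooth h → Torus.HasZeroMean h →
      ∃ (Λ : ℝ → ℝ) (M s₁ : ℝ), s₀ ≤ s₁ ∧ (∀ τ, 0 ≤ Λ τ) ∧ IntegrableOn Λ (Ici 0) ∧ (∫ τ in Ici 0, Λ τ) ≤ M ∧
        ∀ (j : ℕ) (s : ℝ) (φ : ℝ → 𝕋² → ℝ), s₁ ≤ s →
          Torus.IsClassicalScalarTransportOn (Ici s) (ν j) (v j) φ → φ s = h →
          ∀ t, s ≤ t → Torus.scalarL2Sq (φ t) ≤ Λ (t - s) ^ 2 * Torus.scalarL2Sq h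

/-- **What the split would deliver: the ENVELOPE clause of `W` for some `(g, h)`** (the Green–Kubo clause of `W`
then follows only under the tail condition of the landed H1 `stub_gkFloorOfTail`, p118430 — a second reason the
split is weaker than it looks). -/
def EnvelopeWitness : Prop :=
  ∃ (g : 𝕋² → E²) (h : 𝕋² → ℝ),
    Torus.IsSmooth g ∧ Torus.IsDivFree g ∧ Torus.HasZeroMean g ∧ Torus.IsSmooth h ∧ Torus.HasZeroMean h ∧
    ∃ (ν : ℕ → ℝ) (v : ℕ → ℝ → 𝕋² → E²) (p : ℕ → ℝ → 𝕋² → ℝ) (Λ : ℝ → ℝ) (E s₁ M : ℝ),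
      (∀ j, 0 < ν j) ∧ Tendsto ν atTop (𝓝 0) ∧
      (∀ j, Torus.IsClassicalNSSolutionOn (Ici 0) (ν j) (fun _ => g) (v j) (p j)) ∧
      (∀ j t, 0 ≤ t → ∫ x, ‖v j t x‖ ^ 2 ≤ E) ∧
      0 ≤ s₁ ∧ (∀ τ, 0 ≤ Λ τ) ∧ IntegrableOn Λ (Ici 0) ∧ (∫ τ in Ici 0, Λ τ) ≤ M ∧
      ∀ (j : ℕ) (s : ℝ) (φ : ℝ → 𝕋² → ℝ), s₁ ≤ s →
        Torus.IsClassicalScalarTransportOn (Ici s) (ν j) (v j) φ → φ s = h →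
        ∀ t, s ≤ t → Torus.scalarL2Sq (φ t) ≤ Λ (t - s) ^ 2 * Torus.scalarL2Sq h

/-- **Glue of the split (trivial, which is the point):** `Sub₁ → Sub₂ → EnvelopeWitness`, for any fixed smooth
mean-zero pattern (here the first Fourier mode `cos 2πx₁`, whose smoothness/zero mean are taken as hypotheses to
keep this sketch free of calculus).  All difficulty sits in `Sub₁` (realisability by steadily forced NS — the
crux's own core) AND in `Sub₂` (false at fixed rate by the log gate). [folklore] -/
theorem envelopeWitness_of_split (h : 𝕋² → ℝ) (hh : Torus.IsSmooth h) (hh0 : Torus.HasZeroMean h)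
    (h1 : UniformInviscidMixer) (h2 : MixingGivesEnvelope) : EnvelopeWitness := by
  obtain ⟨g, ν, v, p, r, E, s₀, hmix⟩ := h1
  obtain ⟨Λ, M, s₁, hs₁, hΛ0, hΛi, hΛM, henv⟩ := h2 g ν v p r E s₀ hmix h hh hh0
  obtain ⟨hgs, hgd, hgm, hν, hν0, hNS, hE, hs₀, -⟩ := hmix
  exact ⟨g, h, hgs, hgd, hgm, hh, hh0, ν, v, p, Λ, E, s₁, M, hν, hν0, hNS, hE, le_trans hs₀ hs₁, hΛ0, hΛi,
    hΛM, henv⟩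

end Summit.AnomalousDissipation.AnomalousDissipation.Cruxes.TwohalfdThesis.StrategistCensus

end
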